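import Summits.QuantumFields.YangMills.Theorems.VirialFluxGapSharpTwistedLaplaceQuantitativeLaplaceMethod
import Literature.Analysis.Asymptotics.GaussianDamping
import HarnessLib

/-!
# The quantitative Laplace method from SMOOTH data: Taylor forms along rays with explicit remainders,
# and ★★ `laplaceMethod_quantitative_of_contDiff`

Helper module (free-hands work of width seat ym-line-sfw-p2-w2 g49, cell ym-idea-1) toward crux
⟨stmt-QuantumFields-24204⟩ `VirialFluxGap.SharpTwistedLaplace` by the DIRECT Laplace method; PART 5 of the
quantitative Laplace stack (parts 1–3 `…QuantitativeLaplace{Gauss,Pointwise,Method}` = the Euclidean core, part 4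
`…QuantitativeLaplaceOrbit` = critical orbits ∕ several tubes).  Everything here is PROVED; no definitions, no named
facts (namespace `Summit.QuantumFields.YangMills.Theorems.QuantitativeLaplace`).

WHAT THIS FILE ADDS — the consumer-side front end.  The Euclidean core `laplaceMethod_quantitative_of_eqOn` takes
its window data in DECOMPOSED form (`f = ½⟪Ay,y⟫ + c + r`, `w = w₀(1 + ℓ + e)`, `c`, `ℓ` odd with cubic ∕ linear
bounds, `r`, `e` with quartic ∕ quadratic bounds).  A chart delivers instead a SMOOTH phase and weight with bounds
on derivatives.  Here:
* `abs_sub_taylor_three_le` — for `F ∈ C⁴` with `‖D⁴F‖ ≤ M₄`: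
  `|F(y) − (F(0) + DF(0)[y] + ½D²F(0)[y,y] + ⅙D³F(0)[y,y,y])| ≤ M₄‖y‖⁴/6` (Taylor–Lagrange on the ray through `y`,
  Mathlib `taylor_mean_remainder_bound` + the tree's `GaussianBeam.iteratedDeriv_comp_smul`);
* `abs_sub_taylor_one_le` — for `W ∈ C²` with `‖D²W‖ ≤ N₂`: `|W(y) − (W(0) + DW(0)[y])| ≤ N₂‖y‖²`;
* `coercive_of_quadratic_growth` — a quadratic-growth (Łojasiewicz) inequality `κ‖y‖² ≤ F(y)` near `0` forces
  `2κ‖y‖² ≤ ⟪Ay,y⟫` (the transfer of e.g. ✓`TwistEaterVolume.quadraticGrowth_proof`, read along a slice, into `hcoer`);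
* ★★ `laplaceMethod_quantitative_of_contDiff` — for a `C⁴` phase `F` with `F(0) = 0`, `DF(0) = 0`,
  `D²F(0)[y,y] = ⟪Ay,y⟫` (`A` symmetric, `λ‖y‖² ≤ ⟪Ay,y⟫`), `‖D³F(0)‖ ≤ M₃`, `‖D⁴F‖ ≤ M₄`, and a `C²` weight `W` with
  `W(0) = w₀ > 0`, `‖DW(0)‖ ≤ N₁`, `‖D²W‖ ≤ N₂`, a window `R` with `(M₃/6)R + (M₄/6)R² ≤ λ/(8(m+8))`, `(N₁/w₀)R ≤ 1`,
  `(N₂/w₀)R² ≤ 1`, and EVERY `β > 0`: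
  `|∫_{‖y‖≤R} e^{−βF} W − w₀𝔊(β)| ≤ (K/β)·w₀𝔊(β)`, `𝔊(β) = (2π/β)^{m/2}/√det A`, with the core's explicit polynomial
  `K` at `A₃ = M₃/6`, `A₄ = M₄/6`, `D = N₁/w₀`, `G = N₂/w₀` — the cubic Taylor FORM of `F` is the odd part `c` and the
  linear Taylor form of `W` the odd part `ℓ` (this is where the parity cancellation of the `β^{−1/2}` term is fed).

HONEST FRAMING: classical real analysis; width 0 by itself toward any lattice statement; ⟨24204⟩, ⟨24319⟩ and every
rung stay OPEN; the Yang–Mills mass gap (Clay) is NOT touched; no summit is proved by a line.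

## References
* K. W. Breitung, *Asymptotic Approximations for Probability Integrals*, LNM 1592 (1994), Lemma 7 p. 12, Thm 41 p. 56. [Breitung1994]
-/

noncomputable section

open _root_.Set _root_.Filter
open scoped _root_.Topology

namespace Summit.QuantumFields.YangMills.Theorems.QuantitativeLaplace

open Literature.Analysis.Asymptotics.GaussianBeam (iteratedDeriv_comp_smul)

variable {V : Type*} [NormedAddCommGroup V] [InnerProductSpace ℝ V] [FiniteDimensional ℝ V]
  [MeasurableSpace V] [BorelSpace V]

omit [FiniteDimensional ℝ V] [MeasurableSpace V] [BorelSpace V] in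
/-- **Fourth-order Taylor formula along rays with an explicit remainder**: for `F : V → ℝ` of class `C⁴`
with `‖D⁴F‖ ≤ M₄` everywhere,
`|F(y) − (F(0) + DF(0)[y] + ½D²F(0)[y,y] + ⅙D³F(0)[y,y,y])| ≤ M₄‖y‖⁴/6` (Taylor–Lagrange on the ray through
`y`, Mathlib `taylor_mean_remainder_bound`). [folklore] -/
theorem abs_sub_taylor_three_le {F : V → ℝ} (hF : ContDiff ℝ 4 F) {M₄ : ℝ}
    (hM : ∀ y, ‖iteratedFDeriv ℝ 4 F y‖ ≤ M₄) (y : V) :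
    |F y - (F 0 + iteratedFDeriv ℝ 1 F 0 (fun _ => y) + (1 / 2) * iteratedFDeriv ℝ 2 F 0 (fun _ => y)
      + (1 / 6) * iteratedFDeriv ℝ 3 F 0 (fun _ => y))| ≤ M₄ * ‖y‖ ^ 4 / 6 := by
  have hM0 : 0 ≤ M₄ := (norm_nonneg _).trans (hM 0)
  by_cases hy : y = 0
  · subst hy
    have h1 : iteratedFDeriv ℝ 1 F 0 (fun _ => (0 : V)) = 0 :=
      (iteratedFDeriv ℝ 1 F 0).map_zero
    have h2 : iteratedFDeriv ℝ 2 F 0 (fun _ => (0 : V)) = 0 :=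
      (iteratedFDeriv ℝ 2 F 0).map_zero
    have h3 : iteratedFDeriv ℝ 3 F 0 (fun _ => (0 : V)) = 0 :=
      (iteratedFDeriv ℝ 3 F 0).map_zero
    simp [h1, h2, h3]
  set r : ℝ := ‖y‖ with hr
  have hrpos : 0 < r := norm_pos_iff.mpr hy
  set w : V := r⁻¹ • y with hw
  have hyw : y = r • w := by rw [hw, smul_smul, mul_inv_cancel₀ hrpos.ne', one_smul]
  have hwnorm : ‖w‖ = 1 := by rw [hw, norm_smul, norm_inv, norm_norm, inv_mul_cancel₀ hrpos.ne']
  set g : ℝ → ℝ := fun t => F (t • w) with hg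
  have hgdiff : ContDiff ℝ 4 g := by
    simp only [hg]; exact hF.comp ((contDiff_id).smul contDiff_const)
  have hgder : ∀ n ≤ 4, ∀ t, iteratedDeriv n g t = iteratedFDeriv ℝ n F (t • w) fun _ => w :=
    fun n hn t => iteratedDeriv_comp_smul hF w (by exact_mod_cast hn) t
  have hwithin : ∀ n ≤ 4, ∀ t ∈ Icc (0 : ℝ) r,
      iteratedDerivWithin n g (Icc 0 r) t = iteratedDeriv n g t := fun n hn t ht =>
    iteratedDerivWithin_eq_iteratedDeriv (uniqueDiffOn_Icc hrpos)
      (hgdiff.contDiffAt.of_le (by exact_mod_cast hn)) ht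
  have hbound : ∀ t ∈ Icc (0 : ℝ) r, ‖iteratedDerivWithin 4 g (Icc 0 r) t‖ ≤ M₄ := by
    intro t ht
    rw [hwithin 4 le_rfl t ht, hgder 4 le_rfl t]
    refine (ContinuousMultilinearMap.le_opNorm _ _).trans ?_
    simp only [hwnorm, Finset.prod_const_one, mul_one]
    exact hM _
  have htaylor := taylor_mean_remainder_bound (n := 3) hrpos.le hgdiff.contDiffOn
    (right_mem_Icc.mpr hrpos.le) hbound
  -- identify the Taylor polynomial
  have hscale : ∀ k ≤ 4, (iteratedFDeriv ℝ k F 0 fun _ => y) = r ^ k * iteratedFDeriv ℝ k F 0 fun _ => w := by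
    intro k hk
    rw [hyw]
    have := (iteratedFDeriv ℝ k F 0).map_smul_univ (fun _ : Fin k => r) (fun _ => w)
    simp only [Finset.prod_const, Finset.card_univ, Fintype.card_fin, smul_eq_mul] at this
    exact this
  have hpoly : taylorWithinEval g 3 (Icc 0 r) 0 r = F 0 + iteratedFDeriv ℝ 1 F 0 (fun _ => y)
      + (1 / 2) * iteratedFDeriv ℝ 2 F 0 (fun _ => y) + (1 / 6) * iteratedFDeriv ℝ 3 F 0 (fun _ => y) := by
    rw [taylor_within_apply]
    simp only [Finset.sum_range_succ, Finset.sum_range_zero, zero_add, sub_zero, smul_eq_mul]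
    have h0 : iteratedDerivWithin 0 g (Icc 0 r) 0 = F 0 := by
      rw [iteratedDerivWithin_zero]; simp [hg]
    rw [h0, hwithin 1 (by norm_num) 0 (left_mem_Icc.mpr hrpos.le), hwithin 2 (by norm_num) 0 (left_mem_Icc.mpr hrpos.le),
      hwithin 3 (by norm_num) 0 (left_mem_Icc.mpr hrpos.le), hgder 1 (by norm_num) 0, hgder 2 (by norm_num) 0,
      hgder 3 (by norm_num) 0, zero_smul, hscale 1 (by norm_num), hscale 2 (by norm_num), hscale 3 (by norm_num)]
    simp [Nat.factorial]
    ring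
  have hgr : g r = F y := by show F (r • w) = F y; rw [← hyw]
  rw [hpoly, hgr, Real.norm_eq_abs, sub_zero] at htaylor
  calc |F y - (F 0 + iteratedFDeriv ℝ 1 F 0 (fun _ => y) + (1 / 2) * iteratedFDeriv ℝ 2 F 0 (fun _ => y)
        + (1 / 6) * iteratedFDeriv ℝ 3 F 0 (fun _ => y))| ≤ M₄ * r ^ (3 + 1) / (Nat.factorial 3) := htaylor
    _ = M₄ * ‖y‖ ^ 4 / 6 := by rw [hr]; norm_num [Nat.factorial]

omit [FiniteDimensional ℝ V] [MeasurableSpace V] [BorelSpace V] in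
/-- **Second-order Taylor formula along rays with an explicit remainder**: for `W : V → ℝ` of class `C²` with
`‖D²W‖ ≤ N₂` everywhere, `|W(y) − (W(0) + DW(0)[y])| ≤ N₂‖y‖²` (Mathlib's `taylor_mean_remainder_bound`
constant `C·r^{n+1}/n!` at `n = 1`). [folklore] -/
theorem abs_sub_taylor_one_le {W : V → ℝ} (hW : ContDiff ℝ 2 W) {N₂ : ℝ}
    (hN : ∀ y, ‖iteratedFDeriv ℝ 2 W y‖ ≤ N₂) (y : V) :
    |W y - (W 0 + iteratedFDeriv ℝ 1 W 0 (fun _ => y))| ≤ N₂ * ‖y‖ ^ 2 := by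
  have hN0 : 0 ≤ N₂ := (norm_nonneg _).trans (hN 0)
  by_cases hy : y = 0
  · subst hy
    have h1 : iteratedFDeriv ℝ 1 W 0 (fun _ => (0 : V)) = 0 := (iteratedFDeriv ℝ 1 W 0).map_zero
    simp [h1]
  set r : ℝ := ‖y‖ with hr
  have hrpos : 0 < r := norm_pos_iff.mpr hy
  set w : V := r⁻¹ • y with hw
  have hyw : y = r • w := by rw [hw, smul_smul, mul_inv_cancel₀ hrpos.ne', one_smul]
  have hwnorm : ‖w‖ = 1 := by rw [hw, norm_smul, norm_inv, norm_norm, inv_mul_cancel₀ hrpos.ne']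
  set g : ℝ → ℝ := fun t => W (t • w) with hg
  have hgdiff : ContDiff ℝ 2 g := by
    simp only [hg]; exact hW.comp ((contDiff_id).smul contDiff_const)
  have hgder : ∀ n ≤ 2, ∀ t, iteratedDeriv n g t = iteratedFDeriv ℝ n W (t • w) fun _ => w :=
    fun n hn t => iteratedDeriv_comp_smul hW w (by exact_mod_cast hn) t
  have hwithin : ∀ n ≤ 2, ∀ t ∈ Icc (0 : ℝ) r,
      iteratedDerivWithin n g (Icc 0 r) t = iteratedDeriv n g t := fun n hn t ht =>
    iteratedDerivWithin_eq_iteratedDeriv (uniqueDiffOn_Icc hrpos)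
      (hgdiff.contDiffAt.of_le (by exact_mod_cast hn)) ht
  have hbound : ∀ t ∈ Icc (0 : ℝ) r, ‖iteratedDerivWithin 2 g (Icc 0 r) t‖ ≤ N₂ := by
    intro t ht
    rw [hwithin 2 le_rfl t ht, hgder 2 le_rfl t]
    refine (ContinuousMultilinearMap.le_opNorm _ _).trans ?_
    simp only [hwnorm, Finset.prod_const_one, mul_one]
    exact hN _
  have htaylor := taylor_mean_remainder_bound (n := 1) hrpos.le hgdiff.contDiffOn
    (right_mem_Icc.mpr hrpos.le) hbound
  have hscale : (iteratedFDeriv ℝ 1 W 0 fun _ => y) = r ^ 1 * iteratedFDeriv ℝ 1 W 0 fun _ => w := by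
    rw [hyw]
    have := (iteratedFDeriv ℝ 1 W 0).map_smul_univ (fun _ : Fin 1 => r) (fun _ => w)
    simp only [Finset.prod_const, Finset.card_univ, Fintype.card_fin, smul_eq_mul] at this
    exact this
  have hpoly : taylorWithinEval g 1 (Icc 0 r) 0 r = W 0 + iteratedFDeriv ℝ 1 W 0 (fun _ => y) := by
    rw [taylor_within_apply]
    simp only [Finset.sum_range_succ, Finset.sum_range_zero, zero_add, sub_zero, smul_eq_mul]
    have h0 : iteratedDerivWithin 0 g (Icc 0 r) 0 = W 0 := by
      rw [iteratedDerivWithin_zero]; simp [hg]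
    rw [h0, hwithin 1 (by norm_num) 0 (left_mem_Icc.mpr hrpos.le), hgder 1 (by norm_num) 0, zero_smul, hscale]
    simp [Nat.factorial]
  have hgr : g r = W y := by show W (r • w) = W y; rw [← hyw]
  rw [hpoly, hgr, Real.norm_eq_abs, sub_zero] at htaylor
  calc |W y - (W 0 + iteratedFDeriv ℝ 1 W 0 (fun _ => y))| ≤ N₂ * r ^ (1 + 1) / (Nat.factorial 1) := htaylor
    _ = N₂ * ‖y‖ ^ 2 := by rw [hr]; norm_num [Nat.factorial]

open _root_.MeasureTheory _root_.Metric _root_.Module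
open scoped _root_.Real _root_.InnerProductSpace

/-- ★★ **The quantitative Laplace method from SMOOTH data** (front end of `laplaceMethod_quantitative_of_eqOn`):
for a `C⁴` phase `F` with `F(0) = 0`, `DF(0) = 0`, Hessian `D²F(0)[y,y] = ⟪Ay,y⟫` (`A` symmetric,
`λ‖y‖² ≤ ⟪Ay,y⟫`), `‖D³F(0)‖ ≤ M₃`, `‖D⁴F‖ ≤ M₄`, and a `C²` weight `W` with `W(0) = w₀ > 0`, `‖DW(0)‖ ≤ N₁`,
`‖D²W‖ ≤ N₂`, on a window `R` with `(M₃/6)R + (M₄/6)R² ≤ λ/(8(m+8))`, `(N₁/w₀)R ≤ 1`, `(N₂/w₀)R² ≤ 1`, and every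
`β > 0`: `|∫_{‖y‖≤R} e^{−βF} W − w₀𝔊(β)| ≤ (K/β)·w₀𝔊(β)` with the explicit constant of the Euclidean core at
`A₃ = M₃/6`, `A₄ = M₄/6`, `D = N₁/w₀`, `G = N₂/w₀` (the cubic Taylor FORM is the odd part `c`, the linear Taylor form
of `W` the odd part `ℓ`). [cite: Breitung1994, Thm 41 p. 56] -/
theorem laplaceMethod_quantitative_of_contDiff {A : V →ₗ[ℝ] V} {lam : ℝ} (hA : A.IsSymmetric) (hlam : 0 < lam)
    (hcoer : ∀ y : V, lam * ‖y‖ ^ 2 ≤ ⟪A y, y⟫_ℝ)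
    {F W : V → ℝ} (hF : ContDiff ℝ 4 F) (hW : ContDiff ℝ 2 W)
    (hF0 : F 0 = 0) (hF1 : iteratedFDeriv ℝ 1 F 0 = 0)
    (hF2 : ∀ y : V, iteratedFDeriv ℝ 2 F 0 (fun _ => y) = ⟪A y, y⟫_ℝ)
    {M₃ M₄ N₁ N₂ w₀ R β : ℝ} (hM₃ : ‖iteratedFDeriv ℝ 3 F 0‖ ≤ M₃) (hM₄ : ∀ y, ‖iteratedFDeriv ℝ 4 F y‖ ≤ M₄)
    (hw₀ : 0 < w₀) (hW0 : W 0 = w₀) (hN₁ : ‖iteratedFDeriv ℝ 1 W 0‖ ≤ N₁)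
    (hN₂ : ∀ y, ‖iteratedFDeriv ℝ 2 W y‖ ≤ N₂)
    (hR : 0 < R) (hβ : 0 < β)
    (hsmall : M₃ / 6 * R + M₄ / 6 * R ^ 2 ≤ lam / (8 * ((finrank ℝ V : ℝ) + 8)))
    (hN₁R : N₁ / w₀ * R ≤ 1) (hN₂R : N₂ / w₀ * R ^ 2 ≤ 1) :
    |(∫ y in closedBall (0 : V) R, Real.exp (-(β * F y)) * W y) - w₀ * ((2 * π / β) ^ ((finrank ℝ V : ℝ) / 2) / Real.sqrt (LinearMap.det A))| ≤
      (16 * ((finrank ℝ V : ℝ) + 8) / (lam * R ^ 2) + 16 * (N₂ / w₀) * ((finrank ℝ V : ℝ) + 8) / lam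
        + 256 * (M₄ / 6 + (M₃ / 6 + M₄ / 6 * R) * (N₁ / w₀ + N₂ / w₀ * R)) * ((finrank ℝ V : ℝ) + 8) ^ 2 / lam ^ 2
        + 18432 * (M₃ / 6 + M₄ / 6 * R) ^ 2 * ((finrank ℝ V : ℝ) + 8) ^ 3 / lam ^ 3) / β * (w₀ * ((2 * π / β) ^ ((finrank ℝ V : ℝ) / 2) / Real.sqrt (LinearMap.det A))) := by
  -- the Taylor data
  set T₃ := iteratedFDeriv ℝ 3 F 0 with hT₃
  set T₁ := iteratedFDeriv ℝ 1 W 0 with hT₁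
  set c : V → ℝ := fun y => (1 / 6) * T₃ (fun _ => y) with hcdef
  set r : V → ℝ := fun y => F y - (1 / 2) * ⟪A y, y⟫_ℝ - c y with hrdef
  set ℓ : V → ℝ := fun y => T₁ (fun _ => y) / w₀ with hℓdef
  set e : V → ℝ := fun y => (W y - w₀ - T₁ (fun _ => y)) / w₀ with hedef
  have hM₃0 : 0 ≤ M₃ := (norm_nonneg _).trans hM₃
  have hM₄0 : 0 ≤ M₄ := (norm_nonneg _).trans (hM₄ 0)
  have hN₁0 : 0 ≤ N₁ := (norm_nonneg _).trans hN₁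
  have hN₂0 : 0 ≤ N₂ := (norm_nonneg _).trans (hN₂ 0)
  have hw₀' : w₀ ≠ 0 := hw₀.ne'
  -- continuity of `y ↦ M (y, …, y)`
  have hdiag : ∀ {k : ℕ} (M : ContinuousMultilinearMap ℝ (fun _ : Fin k => V) ℝ),
      Continuous fun y : V => M fun _ => y := fun M =>
    M.cont.comp (continuous_pi fun _ => continuous_id)
  have hc_meas : Measurable c := (continuous_const.mul (hdiag T₃)).measurable
  have hℓ_meas : Measurable ℓ := ((hdiag T₁).div_const _).measurable
  have hr_meas : Measurable r :=
    ((hF.continuous.sub (continuous_const.mul ((A.continuous_of_finiteDimensional).inner continuous_id))).sub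
      (continuous_const.mul (hdiag T₃))).measurable
  have he_meas : Measurable e := (((hW.continuous.sub continuous_const).sub (hdiag T₁)).div_const _).measurable
  -- oddness of the Taylor forms of odd degree
  have hodd : ∀ {k : ℕ} (M : ContinuousMultilinearMap ℝ (fun _ : Fin k => V) ℝ) (y : V),
      M (fun _ => -y) = (-1) ^ k * M (fun _ => y) := by
    intro k M y
    have := M.map_smul_univ (fun _ : Fin k => (-1 : ℝ)) (fun _ => y)
    simp only [neg_one_smul, Finset.prod_const, Finset.card_univ, Fintype.card_fin, smul_eq_mul] at this
    exact this
  have hc_odd : ∀ y, c (-y) = -c y := fun y => by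
    simp only [hcdef]; rw [hodd T₃ y]; ring
  have hℓ_odd : ∀ y, ℓ (-y) = -ℓ y := fun y => by
    simp only [hℓdef]; rw [hodd T₁ y]; ring
  -- the bounds
  have hdiag_le : ∀ {k : ℕ} (M : ContinuousMultilinearMap ℝ (fun _ : Fin k => V) ℝ) (y : V),
      |M (fun _ => y)| ≤ ‖M‖ * ‖y‖ ^ k := by
    intro k M y
    have := M.le_opNorm (fun _ => y)
    simp only [Finset.prod_const, Finset.card_univ, Fintype.card_fin] at this
    rwa [← Real.norm_eq_abs]
  have hc : ∀ y : V, ‖y‖ ≤ R → |c y| ≤ M₃ / 6 * ‖y‖ ^ 3 := fun y _ => by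
    simp only [hcdef]
    rw [abs_mul, abs_of_pos (by norm_num : (0 : ℝ) < 1 / 6)]
    have := hdiag_le T₃ y
    calc 1 / 6 * |T₃ fun _ => y| ≤ 1 / 6 * (‖T₃‖ * ‖y‖ ^ 3) := by gcongr
      _ ≤ 1 / 6 * (M₃ * ‖y‖ ^ 3) := by gcongr
      _ = M₃ / 6 * ‖y‖ ^ 3 := by ring
  have hr : ∀ y : V, ‖y‖ ≤ R → |r y| ≤ M₄ / 6 * ‖y‖ ^ 4 := fun y _ => by
    have ht := abs_sub_taylor_three_le hF hM₄ y
    have h1 : iteratedFDeriv ℝ 1 F 0 (fun _ => y) = 0 := by rw [hF1]; rfl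
    rw [hF0, h1, hF2 y] at ht
    have : r y = F y - (0 + 0 + (1 / 2) * ⟪A y, y⟫_ℝ + (1 / 6) * iteratedFDeriv ℝ 3 F 0 (fun _ => y)) := by
      simp only [hrdef, hcdef, hT₃]; ring
    rw [this]
    calc _ ≤ M₄ * ‖y‖ ^ 4 / 6 := ht
      _ = M₄ / 6 * ‖y‖ ^ 4 := by ring
  have hℓ : ∀ y : V, ‖y‖ ≤ R → |ℓ y| ≤ N₁ / w₀ * ‖y‖ := fun y _ => by
    simp only [hℓdef]
    rw [abs_div, abs_of_pos hw₀, div_le_iff₀ hw₀]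
    calc |T₁ fun _ => y| ≤ ‖T₁‖ * ‖y‖ ^ 1 := hdiag_le T₁ y
      _ ≤ N₁ * ‖y‖ ^ 1 := by gcongr
      _ = N₁ / w₀ * ‖y‖ * w₀ := by field_simp
  have he : ∀ y : V, ‖y‖ ≤ R → |e y| ≤ N₂ / w₀ * ‖y‖ ^ 2 := fun y _ => by
    simp only [hedef]
    rw [abs_div, abs_of_pos hw₀, div_le_iff₀ hw₀]
    have ht := abs_sub_taylor_one_le hW hN₂ y
    rw [hW0] at ht
    have : W y - w₀ - T₁ (fun _ => y) = W y - (w₀ + iteratedFDeriv ℝ 1 W 0 (fun _ => y)) := by rw [hT₁]; ring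
    rw [this]
    calc _ ≤ N₂ * ‖y‖ ^ 2 := ht
      _ = N₂ / w₀ * ‖y‖ ^ 2 * w₀ := by field_simp
  have hf : ∀ y : V, ‖y‖ ≤ R → F y = (1 / 2) * ⟪A y, y⟫_ℝ + c y + r y := fun y _ => by
    simp only [hrdef]; ring
  have hw : ∀ y : V, ‖y‖ ≤ R → W y = w₀ * (1 + ℓ y + e y) := fun y _ => by
    simp only [hℓdef, hedef]; field_simp; ring
  exact laplaceMethod_quantitative_of_eqOn hA hlam hcoer hR (by positivity) (by positivity) (by positivity)
    (by positivity) hβ hw₀.le hsmall hN₁R hN₂R hc_meas hr_meas hℓ_meas he_meas hc_odd hℓ_odd hc hr hℓ he hf hw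

omit [FiniteDimensional ℝ V] [MeasurableSpace V] [BorelSpace V] in
/-- **Quadratic growth forces coercivity of the Hessian** (the transfer of a Łojasiewicz∕quadratic-growth
inequality — e.g. the tree's ✓`TwistEaterVolume.quadraticGrowth_proof` read along a slice — into the hypothesis
`hcoer` of the quantitative Laplace theorems): if `F ∈ C⁴`, `F(0) = 0`, `DF(0) = 0`, `D²F(0)[y,y] = ⟪Ay,y⟫`,
`‖D⁴F‖ ≤ M₄`, and `κ‖y‖² ≤ F(y)` for `‖y‖ ≤ R₀` (`R₀ > 0`), then `2κ‖y‖² ≤ ⟪Ay, y⟫` for every `y`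
(divide `F(ty) ≥ κt²‖y‖²` by `t²` and let `t → 0⁺`, the cubic and quartic Taylor terms being `O(t)`). [folklore] -/
theorem coercive_of_quadratic_growth {F : V → ℝ} (hF : ContDiff ℝ 4 F) (hF0 : F 0 = 0)
    (hF1 : iteratedFDeriv ℝ 1 F 0 = 0) {A : V →ₗ[ℝ] V}
    (hF2 : ∀ y : V, iteratedFDeriv ℝ 2 F 0 (fun _ => y) = ⟪A y, y⟫_ℝ)
    {M₄ : ℝ} (hM₄ : ∀ y, ‖iteratedFDeriv ℝ 4 F y‖ ≤ M₄)
    {κ R₀ : ℝ} (hR₀ : 0 < R₀) (hgrowth : ∀ y : V, ‖y‖ ≤ R₀ → κ * ‖y‖ ^ 2 ≤ F y) (y : V) :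
    2 * κ * ‖y‖ ^ 2 ≤ ⟪A y, y⟫_ℝ := by
  by_cases hy : y = 0
  · subst hy; simp
  have hypos : 0 < ‖y‖ := norm_pos_iff.mpr hy
  set T₃ := iteratedFDeriv ℝ 3 F 0 with hT₃
  set c₁ : ℝ := ‖T₃‖ * ‖y‖ ^ 3 / 6 with hc₁
  set c₂ : ℝ := M₄ * ‖y‖ ^ 4 / 6 with hc₂
  have hM₄0 : 0 ≤ M₄ := (norm_nonneg _).trans (hM₄ 0)
  have hc₁0 : 0 ≤ c₁ := by positivity
  have hc₂0 : 0 ≤ c₂ := by positivity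
  -- scaling of the Taylor forms along the ray
  have hscale : ∀ {k : ℕ} (M : ContinuousMultilinearMap ℝ (fun _ : Fin k => V) ℝ) (t : ℝ),
      M (fun _ => t • y) = t ^ k * M (fun _ => y) := by
    intro k M t
    have := M.map_smul_univ (fun _ : Fin k => t) (fun _ => y)
    simp only [Finset.prod_const, Finset.card_univ, Fintype.card_fin, smul_eq_mul] at this
    exact this
  -- the key inequality for every small `t > 0`
  have hkey : ∀ t : ℝ, 0 < t → t ≤ 1 → t * ‖y‖ ≤ R₀ →
      κ * ‖y‖ ^ 2 ≤ (1 / 2) * ⟪A y, y⟫_ℝ + t * (c₁ + c₂) := by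
    intro t ht ht1 htR
    have htay := abs_sub_taylor_three_le hF hM₄ (t • y)
    have h1 : iteratedFDeriv ℝ 1 F 0 (fun _ => t • y) = 0 := by rw [hF1]; rfl
    have h2 : iteratedFDeriv ℝ 2 F 0 (fun _ => t • y) = t ^ 2 * ⟪A y, y⟫_ℝ := by rw [hscale, hF2]
    have h3 : iteratedFDeriv ℝ 3 F 0 (fun _ => t • y) = t ^ 3 * T₃ (fun _ => y) := by rw [hT₃, hscale]
    rw [hF0, h1, h2, h3, norm_smul, Real.norm_eq_abs, abs_of_pos ht] at htay
    have hgr := hgrowth (t • y) (by rw [norm_smul, Real.norm_eq_abs, abs_of_pos ht]; exact htR)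
    rw [norm_smul, Real.norm_eq_abs, abs_of_pos ht] at hgr
    have hT₃b : |T₃ fun _ => y| ≤ ‖T₃‖ * ‖y‖ ^ 3 := by
      have := T₃.le_opNorm (fun _ => y)
      simp only [Finset.prod_const, Finset.card_univ, Fintype.card_fin] at this
      rwa [← Real.norm_eq_abs]
    have hab := (abs_le.mp htay).1
    -- `κ t²‖y‖² ≤ F(ty) ≤ ½t²⟪Ay,y⟫ + t³|T₃|/6 + M₄t⁴‖y‖⁴/6`
    have hF_le : F (t • y) ≤ (1 / 2) * (t ^ 2 * ⟪A y, y⟫_ℝ) + t ^ 3 * c₁ + t ^ 4 * c₂ := by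
      have h6 : (1 / 6) * (t ^ 3 * T₃ fun _ => y) ≤ t ^ 3 * c₁ := by
        rw [hc₁]
        have := (le_abs_self (T₃ fun _ => y)).trans hT₃b
        nlinarith [pow_pos ht 3]
      have := (abs_le.mp htay).2
      rw [hc₂]
      nlinarith
    have hmain : κ * (t * ‖y‖) ^ 2 ≤ (1 / 2) * (t ^ 2 * ⟪A y, y⟫_ℝ) + t ^ 3 * c₁ + t ^ 4 * c₂ := hgr.trans hF_le
    -- divide by `t²` and use `t ≤ 1`
    have ht2 : 0 < t ^ 2 := pow_pos ht 2
    have h4 : t ^ 4 * c₂ ≤ t ^ 3 * c₂ := by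
      have : t ^ 4 ≤ t ^ 3 := by nlinarith [pow_pos ht 3]
      exact mul_le_mul_of_nonneg_right this hc₂0
    have : κ * ‖y‖ ^ 2 * t ^ 2 ≤ ((1 / 2) * ⟪A y, y⟫_ℝ + t * (c₁ + c₂)) * t ^ 2 := by nlinarith
    exact le_of_mul_le_mul_right this ht2
  -- let `t → 0⁺`
  refine (show 2 * κ * ‖y‖ ^ 2 = 2 * (κ * ‖y‖ ^ 2) by ring) ▸ ?_
  suffices h : κ * ‖y‖ ^ 2 ≤ (1 / 2) * ⟪A y, y⟫_ℝ by linarith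
  refine le_of_forall_pos_le_add fun ε hε => ?_
  set t₀ : ℝ := min (min 1 (R₀ / ‖y‖)) (ε / (c₁ + c₂ + 1)) with ht₀
  have ht₀pos : 0 < t₀ := by
    rw [ht₀]; refine lt_min (lt_min one_pos (div_pos hR₀ hypos)) (div_pos hε (by positivity))
  have ht₀1 : t₀ ≤ 1 := (min_le_left _ _).trans (min_le_left _ _)
  have ht₀R : t₀ * ‖y‖ ≤ R₀ := by
    have : t₀ ≤ R₀ / ‖y‖ := (min_le_left _ _).trans (min_le_right _ _)
    rwa [le_div_iff₀ hypos] at this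
  have ht₀ε : t₀ * (c₁ + c₂) ≤ ε := by
    have h1 : t₀ ≤ ε / (c₁ + c₂ + 1) := min_le_right _ _
    rw [le_div_iff₀ (by positivity)] at h1
    nlinarith
  linarith [hkey t₀ ht₀pos ht₀1 ht₀R]

end Summit.QuantumFields.YangMills.Theorems.QuantitativeLaplace
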